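import Literature.MathematicalPhysics.QuantumFieldTheory.Balaban1983to89.B9AppChiral
import Literature.MathematicalPhysics.QuantumFieldTheory.Balaban1983to89.B12AverageCorridor267
import Literature.MathematicalPhysics.QuantumFieldTheory.Balaban1983to89.B7Eq214Flat

/-!
# `Balaban1983to89.B9Eq3194Derivative` — T. Bałaban, *Propagators for lattice gauge theories in a background field*,
# Commun. Math. Phys. **99** (1985) 389–434 [Balaban1985BackgroundPropagators], Appendix p. 433, (3.193)–(3.194):
# THE LINEAR TERM `Q_j(U)A` OF THE NON-LINEAR AVERAGE `Q_j(U, A)` OF A CHIRAL FIELD EXISTS and is given by an explicit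
# level recursion — file 1 of 2 of the row `B9.App` display (3.194) (file 2: `B9Eq3194LinearTerm`, the bound on `F_{2,j}(U)`)

statement-level skeleton of published theorems with citation tags; proofs where landed; nothing here is a claim about the Yang–Mills mass gap

PDF held: `paper:balaban1985-cmp99-background-propagators` (journal page = PDF page + 388); render
`run/shared/lean/pub/pub-balaban/b2b-balaban-ref1/pages/1985-cmp99-background-propagators/1985-cmp99-background-propagators-p045-x2.png`
(p. 433, READ AS AN IMAGE by this seat, 2026-08-21); the averaging (78)–(80) of [5] = T. Bałaban, *Averaging operations for lattice
gauge theories*, Commun. Math. Phys. **98** (1985) 17–51 [Balaban1985Averaging] p. 30 through the tree modules `B7Eq99Concrete` /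
`B7Eq84Concrete` (quoted there).

CITATION HEADER (lean-in-tree rule) / WHAT IS REPRODUCED.  lit-balaban SKELETON row `B9.App` (Appendix (3.188)–(3.194),
pp. 432–433; reader r06 `B9AppChiral`, which types (3.193) and records «(3.194) is a smallness remark without a printed constant:
NOT typed»).  PRINT (p. 433, verbatim from the render): "A similar situation holds for averaging operations. They are given by the
formulas (61), (78)–(80) in [5], with the external gauge field U₀ = 1. Taking
Q_j(U, A) = (1/i) log Ũ′ʲ = (1/i) log (U′U)‾ʲ (Ūʲ)⁻¹ (3.193)
and expanding in A, we can easily see that for the linear term we have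
Q_j(U)A = Q′_jA + F_{2,j}(U)A, (3.194)
where the operator F_{2,j}(U) is small."

WHAT THIS FILE PROVES (kernel, no `sorry`, standard axioms; `U′ = e^{iA}`, `U : ℤ^d → 𝔸ˣ` the chiral background, `𝔸` any
complete normed `ℂ`-algebra with `‖1‖ = 1`; the averages are the tree's concrete `ℤ^d` objects of [5] at `U₀ = 1`:
`B7Eq84Concrete.uavg L 1` (79)–(80), one step = the site average (78) `B7Eq99Concrete.savg`):
* §1 `hasDerivAt_units_inv` — the velocity of the pointwise inverse of a curve of units.
* §2 ONE STEP OF (78) DIFFERENTIATED AT A GENERAL POINT.  For a curve `t ↦ g_t` of unit-valued site functions with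
  logarithmic velocities `λ(x)` (`ġ₀(x) = λ(x)g₀(x)`) the average `{g_t(x)}_{x∈B(y)} = g_t(y)·exp[Σ_x L^{−d} log g_t(y)⁻¹g_t(x)]`
  has logarithmic velocity `stepLam L g₀ λ y = λ(y) + Ad_{g₀(y)}Φ_{S₀}(Σ_x L^{−d}(D log)_{W_x}[Ad_{g₀(y)⁻¹}(λ(x) − λ(y))·W_x])`
  (`W_x = g₀(y)⁻¹g₀(x)`, `S₀ = Σ_x L^{−d} log W_x`, `(D log)_W`, `(D exp)_S`, `Φ_S = (D exp)_S(·)e^{−S}`, `Ad` = the tree's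
  `B12AverageCorridor267.Dmlog / Dexp / PhiY / AdU` BY NAME) — `hasDerivAt_savg`, under the sole condition that the `W_x`
  lie in the disc `|W − 1| < 1` of the series logarithm (21) of [5].
* §3 THE TOWER.  Along `u_t = e^{tμ}U` (`pertU`) the `l`-fold averages `ū_tˡ = uavg L 1 u_t l` have logarithmic velocities
  `lamTower L U μ l` (the recursion `λ₀ = μ`, `λ_{l+1}(z) = stepLam L Ūˡ λ_l (Lz)`): `hasDerivAt_uavg_pertU`, for every `U`
  whose level quantities `Ūˡ(Lz)⁻¹Ūˡ(Lz + r)` (the (167)-quantities of [5] at `U₀ = 1`) lie in the disc of the logarithm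
  (`LogDom`; from (167) `B7Eq167Flat.Cond167 L 1 U j α η` with `αLʲη < 1`: `logDom_of_cond167`).
* §4 (3.193) ⇒ THE LINEAR TERM: `hasDerivAt_Qj` — `t ↦ Q_j(U, tA)(y)` (r06's `B9AppChiral.Qj`) is differentiable at `t = 0`
  with derivative `(1/i)·lamTower L U (iA) j y`; the linear term **`linQj`** `:= d/dt|₀ Q_j(U, tA)(y)` (print DEFINES
  `Q_j(U)A` as the linear Taylor term; as in the tree's `B7Prop3GeneralLinear.linQcov` it is typed as the derivative along
  the complex ray), **`F2`** `:= linQj − Q′_j A` with `Q′_j` = the `j`-fold block mean = `B7Eq214Flat.lamAvg L j` (the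
  operator `Q′_j(1)` of (3.19) p. 394 / (212) of [5] at `U₀ = 1`), and **`eq3194`**: `Q_j(U)A = Q′_jA + F_{2,j}(U)A`.
The smallness «the operator F_{2,j}(U) is small» is made quantitative in file 2 (`B9Eq3194LinearTerm`): for unitary-valued
regular `U` ((167) of [5] at `U₀ = 1`, NO smallness of `U − 1` — a chiral background is not near the identity)
`‖F_{2,j}(U)A(y)‖ ≤ C(d)·α·ω(A)·η·L^{2j}`.

DIVERGENCES / READINGS.  (a) «expanding in A» = differentiability in `t` of `Q_j(U, tA)` at `0` along the complex ray (no
analyticity in `A` as a Banach variable is claimed here); (b) the logarithm is the tree's series logarithm (21) of [5]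
(`MatrixLog.mlog`), so the derivative exists as soon as the (167)-quantities of `U` are in its disc — the only hypothesis;
(c) `ℤ^d` carriers, `1/i` kept as `I⁻¹ •` exactly as in `B9AppChiral.Qj`.  RELATED, NOT DUPLICATED: at `U = 1` the
statement is B8 p. 80 / B9 p. 394 «Q′_j are linear parts of the averaging operations for u = e^{iλ}», proved in the tree as
`B7Eq78Linearization.hasDerivAt_invI_smul_mlog_Rbar` (curves through `1`); here the base point `U` is a general regular chiral
field, whence the Fréchet derivatives of `log`/`exp` at general points.  Unit `lit-balaban-p05` gen 4
(literature-prover-lit-balaban-p05-g4-0); Phase-2 row `B9.App` (owner r06, referee ref-4); HOME `run/shared/lean/pub/lit-balaban/`.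
NOT summit progress.
-/

noncomputable section

open NormedSpace Finset Complex

namespace Literature.MathematicalPhysics.QuantumFieldTheory.Balaban1983to89.B9Eq3194Derivative

open B7Prop1Explicit MatrixLog B7Eq99Concrete B7Eq84Concrete B7Eq92Concrete
open B7Eq170Flat (bmean bmean_apply bmean_const bmean_add)
open B7Eq214Flat (lamAvg lamAvg_zero lamAvg_succ)
open B7Eq167Flat (Cond167)
open B7Prop8Flat (cond167_one_left_iff expUnit_zero)
open B12AverageCorridor267 (Dmlog Dexp PhiY PhiY_apply AdU AdU_apply hasFDerivAt_mlog hasFDerivAt_exp_Dexp Dmlog_one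
  Dexp_zero)
open B7Eq78Linearization (hasDerivAt_mlog_comp hasDerivAt_exp_smul_zero)
open B9AppChiral (Qj Qj_apply)

-- `Site` alone would resolve to the torus sites of `Setup.lean`; re-export the `ℤ^d` sites of `B7Prop1Explicit`.
export B7Prop1Explicit (Site)

variable {d : ℕ}

variable {𝔸 : Type*} [NormedRing 𝔸] [NormedAlgebra ℂ 𝔸] [CompleteSpace 𝔸]

/-! ## §1 The velocity of the inverse of a curve of units -/

section Calculus

/-- `d/dt g_t⁻¹ = −g_{t₀}⁻¹ ġ g_{t₀}⁻¹` for a curve of units (Mathlib `hasFDerivAt_ringInverse`) — used at every site for the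
block quantities `g_t(y)⁻¹g_t(x)` of (78). [folklore] [cite: Balaban1985Averaging, (78) p.30] -/
theorem hasDerivAt_units_inv {G : ℂ → 𝔸ˣ} {D : 𝔸} {t₀ : ℂ} (h : HasDerivAt (fun t => ((G t : 𝔸ˣ) : 𝔸)) D t₀) :
    HasDerivAt (fun t => (((G t)⁻¹ : 𝔸ˣ) : 𝔸))
      (-((((G t₀)⁻¹ : 𝔸ˣ) : 𝔸) * D * (((G t₀)⁻¹ : 𝔸ˣ) : 𝔸))) t₀ := by
  have e : (fun t => (((G t)⁻¹ : 𝔸ˣ) : 𝔸)) = (Ring.inverse : 𝔸 → 𝔸) ∘ fun t => ((G t : 𝔸ˣ) : 𝔸) :=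
    funext fun t => (Ring.inverse_unit (G t)).symm
  rw [e]
  have hF := (hasFDerivAt_ringInverse (𝕜 := ℂ) (G t₀)).comp_hasDerivAt t₀ h
  refine hF.congr_deriv ?_
  simp

end Calculus

/-! ## §2 One step of (78) differentiated at a general point -/

section OneStep

variable (L : ℕ)

omit [NormedAlgebra ℂ 𝔸] [CompleteSpace 𝔸] in
/-- The block quantity of (78): `W_x(g, y) = g(y)⁻¹g(x)`, `x = y + r`, `r ∈ [0, L)^d` — the argument of the logarithm in
"{g(x)}_{x∈B(y)} = g(y)exp[Σ_{x∈B(y)}L^{−d} log g(y)⁻¹g(x)]". [cite: Balaban1985Averaging, (78) p.30] -/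
def Wr (g : Site d → 𝔸ˣ) (y : Site d) (r : Fin d → Fin L) : 𝔸ˣ := (g y)⁻¹ * g (y + boxVec L r)

omit [NormedAlgebra ℂ 𝔸] [CompleteSpace 𝔸] in
/-- Unfolding `Wr`. [cite: Balaban1985Averaging, (78) p.30] -/
theorem Wr_apply (g : Site d → 𝔸ˣ) (y : Site d) (r : Fin d → Fin L) : Wr L g y r = (g y)⁻¹ * g (y + boxVec L r) := rfl

omit [CompleteSpace 𝔸] in
/-- The exponent of (78) is the block mean of the logarithms of the `W_x`. [cite: Balaban1985Averaging, (78) p.30] -/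
theorem Sexp_eq_sum_Wr (g : Site d → 𝔸ˣ) (y : Site d) :
    Sexp L g y = ∑ r : Fin d → Fin L, (((L : ℝ) ^ d)⁻¹) • mlog ((Wr L g y r : 𝔸ˣ) : 𝔸) := rfl

/-- **The derivative of the exponent of (78)** along a curve with logarithmic velocities `λ`:
`Ṡ = Σ_x L^{−d} (D log)_{W_x}[Ad_{g(y)⁻¹}(λ(x) − λ(y))·W_x]` ("expanding in A", p. 433; `(D log)_W`, `Ad` = the tree's
`B12AverageCorridor267.Dmlog`, `AdU`). [cite: Balaban1985BackgroundPropagators, (3.193)–(3.194) p.433]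
[cite: Balaban1985Averaging, (78) p.30] -/
def dSexp (g : Site d → 𝔸ˣ) (lam : Site d → 𝔸) (y : Site d) : 𝔸 :=
  ∑ r : Fin d → Fin L, (((L : ℝ) ^ d)⁻¹) •
    Dmlog ((Wr L g y r : 𝔸ˣ) : 𝔸) (AdU (g y)⁻¹ (lam (y + boxVec L r) - lam y) * ((Wr L g y r : 𝔸ˣ) : 𝔸))

/-- **The logarithmic velocity of the one-step average (78)**: `λ′(y) = λ(y) + Ad_{g(y)}Φ_{S}(Ṡ)`, `S` = the exponent of (78),
`Φ_S = (D exp)_S(·)e^{−S}` (`B12AverageCorridor267.PhiY`). [cite: Balaban1985BackgroundPropagators, (3.193)–(3.194) p.433]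
[cite: Balaban1985Averaging, (78) p.30] -/
def stepLam (g : Site d → 𝔸ˣ) (lam : Site d → 𝔸) (y : Site d) : 𝔸 :=
  lam y + AdU (g y) (PhiY (Sexp L g y) (dSexp L g lam y))

/-- The block quantity `W_x` along the curve: `Ẇ_x = Ad_{g₀(y)⁻¹}(λ(x) − λ(y))·W_x` when `ġ₀ = λg₀` at `y` and at `x`.
[cite: Balaban1985BackgroundPropagators, (3.193)–(3.194) p.433] [cite: Balaban1985Averaging, (78) p.30] -/
theorem hasDerivAt_val_Wr {G : ℂ → Site d → 𝔸ˣ} {lam : Site d → 𝔸} {y : Site d} {r : Fin d → Fin L}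
    (hy : HasDerivAt (fun t => ((G t y : 𝔸ˣ) : 𝔸)) (lam y * G 0 y) 0)
    (hr : HasDerivAt (fun t => ((G t (y + boxVec L r) : 𝔸ˣ) : 𝔸))
      (lam (y + boxVec L r) * G 0 (y + boxVec L r)) 0) :
    HasDerivAt (fun t => ((Wr L (G t) y r : 𝔸ˣ) : 𝔸))
      (AdU (G 0 y)⁻¹ (lam (y + boxVec L r) - lam y) * ((Wr L (G 0) y r : 𝔸ˣ) : 𝔸)) 0 := by
  have h := (hasDerivAt_units_inv hy).mul hr
  have e : (fun t => ((Wr L (G t) y r : 𝔸ˣ) : 𝔸))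
      = (fun t => (((G t y)⁻¹ : 𝔸ˣ) : 𝔸)) * fun t => ((G t (y + boxVec L r) : 𝔸ˣ) : 𝔸) := by
    funext t
    simp only [Wr, Units.val_mul, Pi.mul_apply]
  rw [e]
  refine h.congr_deriv ?_
  rw [AdU_apply, inv_inv, Wr, Units.val_mul]
  set a : 𝔸 := ((G 0 y : 𝔸ˣ) : 𝔸)
  set ai : 𝔸 := (((G 0 y)⁻¹ : 𝔸ˣ) : 𝔸)
  set b : 𝔸 := ((G 0 (y + boxVec L r) : 𝔸ˣ) : 𝔸)
  set l : 𝔸 := lam y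
  set m : 𝔸 := lam (y + boxVec L r)
  have hai : a * ai = 1 := Units.mul_inv _
  have e1 : -(ai * (l * a) * ai) * b = -(ai * l * (a * ai) * b) := by noncomm_ring
  have e2 : ai * (m - l) * a * (ai * b) = ai * (m - l) * (a * ai) * b := by noncomm_ring
  rw [e1, e2, hai]
  noncomm_ring

/-- `e^{−S}e^{S} = 1`. [folklore] [cite: Balaban1985Averaging, (78) p.30] -/
private theorem exp_neg_mul_exp (S : 𝔸) : exp (-S) * exp S = 1 := by
  have h := Units.inv_mul (expUnit S)
  rwa [val_inv_expUnit, val_expUnit, val_expUnit] at h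

/-- **(78) DIFFERENTIATED AT A GENERAL POINT.**  Let `t ↦ g_t` be a curve of unit-valued site functions with
`d/dt|₀ g_t(x) = λ(x)g₀(x)` at the block corner `y` and at the block points `x = y + r`, and let every `W_x = g₀(y)⁻¹g₀(x)` lie in
the disc `|W − 1| < 1` of the logarithm (21) of [5].  Then the one-step average `{g_t(x)}_{x∈B(y)}` (`B7Eq99Concrete.savg`) has
`d/dt|₀ = (stepLam L g₀ λ y)·{g₀(x)}_{x∈B(y)}` — product rule, `(D log)_{W_x}` (`hasFDerivAt_mlog`) and `(D exp)_S`
(`hasFDerivAt_exp_Dexp`) of `B12AverageCorridor267`.  This is the «expanding in A … the linear term» of p. 433 for one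
averaging step around a GENERAL regular chiral field. [cite: Balaban1985BackgroundPropagators, (3.193)–(3.194) p.433]
[cite: Balaban1985Averaging, (78) p.30] -/
theorem hasDerivAt_savg [NormOneClass 𝔸] {G : ℂ → Site d → 𝔸ˣ} {lam : Site d → 𝔸} (y : Site d)
    (hy : HasDerivAt (fun t => ((G t y : 𝔸ˣ) : 𝔸)) (lam y * G 0 y) 0)
    (hr : ∀ r : Fin d → Fin L,
      HasDerivAt (fun t => ((G t (y + boxVec L r) : 𝔸ˣ) : 𝔸)) (lam (y + boxVec L r) * G 0 (y + boxVec L r)) 0)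
    (hdom : ∀ r : Fin d → Fin L, ‖((Wr L (G 0) y r : 𝔸ˣ) : 𝔸) - 1‖ < 1) :
    HasDerivAt (fun t => ((savg L (G t) y : 𝔸ˣ) : 𝔸)) (stepLam L (G 0) lam y * savg L (G 0) y) 0 := by
  -- the logarithms of the block quantities
  have hlog : ∀ r : Fin d → Fin L, HasDerivAt (fun t => mlog ((Wr L (G t) y r : 𝔸ˣ) : 𝔸))
      (Dmlog ((Wr L (G 0) y r : 𝔸ˣ) : 𝔸)
        (AdU (G 0 y)⁻¹ (lam (y + boxVec L r) - lam y) * ((Wr L (G 0) y r : 𝔸ˣ) : 𝔸))) 0 := by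
    intro r
    have h := (hasFDerivAt_mlog (hdom r)).comp_hasDerivAt_of_eq (0 : ℂ) (hasDerivAt_val_Wr L hy (hr r)) rfl
    simpa only [Function.comp_def] using h
  -- the exponent
  have hS : HasDerivAt (fun t => Sexp L (G t) y) (dSexp L (G 0) lam y) 0 := by
    have e : (fun t => Sexp L (G t) y)
        = fun t => ∑ r : Fin d → Fin L, (((L : ℝ) ^ d)⁻¹) • mlog ((Wr L (G t) y r : 𝔸ˣ) : 𝔸) :=
      funext fun t => Sexp_eq_sum_Wr L (G t) y
    rw [e, dSexp]
    exact HasDerivAt.fun_sum fun r _ => (hlog r).fun_const_smul (((L : ℝ) ^ d)⁻¹)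
  -- the exponential
  have hE : HasDerivAt (fun t => exp (Sexp L (G t) y)) (Dexp (Sexp L (G 0) y) (dSexp L (G 0) lam y)) 0 := by
    have h := (hasFDerivAt_exp_Dexp (Sexp L (G 0) y)).comp_hasDerivAt_of_eq (0 : ℂ) hS rfl
    simpa only [Function.comp_def] using h
  -- the product
  have e : (fun t => ((savg L (G t) y : 𝔸ˣ) : 𝔸)) = fun t => ((G t y : 𝔸ˣ) : 𝔸) * exp (Sexp L (G t) y) := by
    funext t
    simp only [savg_apply, Units.val_mul, val_expUnit]
  rw [e]
  refine (hy.mul hE).congr_deriv ?_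
  rw [stepLam, AdU_apply, PhiY_apply, savg_apply, Units.val_mul, val_expUnit]
  set g : 𝔸 := ((G 0 y : 𝔸ˣ) : 𝔸)
  set gi : 𝔸 := (((G 0 y)⁻¹ : 𝔸ˣ) : 𝔸)
  set eS : 𝔸 := exp (Sexp L (G 0) y)
  set eN : 𝔸 := exp (-Sexp L (G 0) y)
  set D : 𝔸 := Dexp (Sexp L (G 0) y) (dSexp L (G 0) lam y)
  have h1 : eN * eS = 1 := exp_neg_mul_exp _
  have h2 : gi * g = 1 := Units.inv_mul _
  symm
  calc (lam y + g * (D * eN) * gi) * (g * eS)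
      = lam y * g * eS + g * D * (eN * ((gi * g) * eS)) := by noncomm_ring
    _ = lam y * g * eS + g * D := by rw [h2, one_mul, h1, mul_one]

end OneStep

/-! ## §3 The tower of averages (79)–(80) along `u_t = e^{tμ}U` -/

section Tower

variable (L : ℕ)

/-- The fluctuation curve around the chiral background: `u_t(x) = e^{tμ(x)}U(x)` (print's `U′U`, `U′ = e^{iA}`, `μ = iA`,
scaled). [cite: Balaban1985BackgroundPropagators, (3.193) p.433] -/
def pertU (μ : Site d → 𝔸) (U : Site d → 𝔸ˣ) (t : ℂ) : Site d → 𝔸ˣ := fun x => expUnit (t • μ x) * U x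

/-- Unfolding `pertU`. [cite: Balaban1985BackgroundPropagators, (3.193) p.433] -/
theorem pertU_apply (μ : Site d → 𝔸) (U : Site d → 𝔸ˣ) (t : ℂ) (x : Site d) :
    pertU μ U t x = expUnit (t • μ x) * U x := rfl

/-- At `t = 0` the curve sits at the background: `u₀ = U`. [cite: Balaban1985BackgroundPropagators, (3.193) p.433] -/
@[simp] theorem pertU_zero (μ : Site d → 𝔸) (U : Site d → 𝔸ˣ) : pertU μ U 0 = U := by
  funext x
  rw [pertU_apply, zero_smul, expUnit_zero, one_mul]

/-- The curve has logarithmic velocity `μ`: `d/dt|₀ u_t(x) = μ(x)U(x)`. [cite: Balaban1985BackgroundPropagators, (3.193) p.433] -/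
theorem hasDerivAt_pertU (μ : Site d → 𝔸) (U : Site d → 𝔸ˣ) (x : Site d) :
    HasDerivAt (fun t => ((pertU μ U t x : 𝔸ˣ) : 𝔸)) (μ x * pertU μ U 0 x) 0 := by
  rw [pertU_zero]
  simp only [pertU_apply, Units.val_mul, val_expUnit]
  exact (hasDerivAt_exp_smul_zero (μ x)).mul_const _

/-- **The logarithmic velocities of the level averages**: `λ₀ = μ`, `λ_{l+1}(z) = stepLam L Ūˡ λ_l (Lz)` — the linear term of
`(U′U)‾ʲ` in print's «expanding in A» at the `l`-fold averaged background `Ūˡ = uavg L 1 U l` ((79)–(80) of [5] at `U₀ = 1`).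
[cite: Balaban1985BackgroundPropagators, (3.193)–(3.194) p.433] [cite: Balaban1985Averaging, (79)–(80) p.30] -/
def lamTower (U : Site d → 𝔸ˣ) (μ : Site d → 𝔸) : ℕ → Site d → 𝔸
  | 0 => μ
  | l + 1 => fun z => stepLam L (uavg L 1 U l) (lamTower U μ l) ((L : ℤ) • z)

/-- `lamTower_zero`. [cite: Balaban1985BackgroundPropagators, (3.193)–(3.194) p.433] -/
@[simp] theorem lamTower_zero (U : Site d → 𝔸ˣ) (μ : Site d → 𝔸) : lamTower L U μ 0 = μ := rfl

/-- `lamTower_succ`. [cite: Balaban1985BackgroundPropagators, (3.193)–(3.194) p.433] -/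
theorem lamTower_succ (U : Site d → 𝔸ˣ) (μ : Site d → 𝔸) (l : ℕ) (z : Site d) :
    lamTower L U μ (l + 1) z = stepLam L (uavg L 1 U l) (lamTower L U μ l) ((L : ℤ) • z) := rfl

/-- **The domain condition**: the (167)-quantities `Ūˡ(Lz)⁻¹Ūˡ(Lz + r)` of the background at the levels `l < j` lie in the disc
`|W − 1| < 1` of the series logarithm (21) of [5] («We consider only regular background fields U», p. 433; [5] p. 44: "we have to
calculate a logarithm of the expression in (167) and this expression is small"). [cite: Balaban1985BackgroundPropagators, p.433]
[cite: Balaban1985Averaging, (167) p.44] -/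
def LogDom (U : Site d → 𝔸ˣ) (j : ℕ) : Prop :=
  ∀ l < j, ∀ (z : Site d) (r : Fin d → Fin L), ‖((Wr L (uavg L 1 U l) ((L : ℤ) • z) r : 𝔸ˣ) : 𝔸) - 1‖ < 1

/-- The domain condition from (167) of [5] at `U₀ = 1` (`B7Eq167Flat.Cond167 L 1 U j α η`:
`‖Ūˡ(Lz)⁻¹Ūˡ(Lz+r) − 1‖ ≤ αL^{l+1}η`, `l < j`) as soon as `αLʲη < 1`. [cite: Balaban1985Averaging, (167) p.44] -/
theorem logDom_of_cond167 {U : Site d → 𝔸ˣ} {j : ℕ} {α η : ℝ} (h : Cond167 L 1 U j α η) (hL : 1 ≤ L) (hα : 0 ≤ α)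
    (hη : 0 ≤ η) (hs : α * (L : ℝ) ^ j * η < 1) : LogDom L U j := by
  rw [cond167_one_left_iff] at h
  intro l hl z r
  have hLr : (1 : ℝ) ≤ L := by exact_mod_cast hL
  calc ‖((Wr L (uavg L 1 U l) ((L : ℤ) • z) r : 𝔸ˣ) : 𝔸) - 1‖ ≤ α * (L : ℝ) ^ (l + 1) * η := h l hl z r
    _ ≤ α * (L : ℝ) ^ j * η :=
        mul_le_mul_of_nonneg_right (mul_le_mul_of_nonneg_left (pow_le_pow_right₀ hLr hl) hα) hη
    _ < 1 := hs

/-- **THE TOWER (79)–(80) ALONG `u_t = e^{tμ}U` IS DIFFERENTIABLE AT `t = 0` WITH LOGARITHMIC VELOCITIES `lamTower`**: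
`d/dt|₀ ū_tˡ(y) = (lamTower L U μ l y)·Ūˡ(y)` for every `l ≤ j`, under the domain condition at the levels `< j` — induction on
`l`, the step being `hasDerivAt_savg` at the background `Ūˡ` (`B7Eq84Concrete.uavg_succ_one_left`). This is «expanding in A» of
p. 433 for `(U′U)‾ʲ` (the `A`-dependence of (3.193) sits in `U′ = e^{iA}` only). [cite: Balaban1985BackgroundPropagators, (3.193)–(3.194) p.433]
[cite: Balaban1985Averaging, (79)–(80) p.30] -/
theorem hasDerivAt_uavg_pertU [NormOneClass 𝔸] {U : Site d → 𝔸ˣ} {μ : Site d → 𝔸} {j : ℕ} (hdom : LogDom L U j) :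
    ∀ l ≤ j, ∀ y : Site d,
      HasDerivAt (fun t => ((uavg L 1 (pertU μ U t) l y : 𝔸ˣ) : 𝔸)) (lamTower L U μ l y * uavg L 1 U l y) 0 := by
  intro l
  induction l with
  | zero =>
    intro _ y
    simpa only [uavg_zero, lamTower_zero, pertU_zero] using hasDerivAt_pertU μ U y
  | succ l ih =>
    intro hl z
    have hll : l < j := Nat.lt_of_succ_le hl
    have ih' := ih hll.le
    have e : (fun t => ((uavg L 1 (pertU μ U t) (l + 1) z : 𝔸ˣ) : 𝔸))
        = fun t => ((savg L (uavg L 1 (pertU μ U t) l) ((L : ℤ) • z) : 𝔸ˣ) : 𝔸) := by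
      funext t
      rw [uavg_succ_one_left]
    rw [e, lamTower_succ, uavg_succ_one_left]
    have h := hasDerivAt_savg L (G := fun t => uavg L 1 (pertU μ U t) l) (lam := lamTower L U μ l) ((L : ℤ) • z)
      (by simpa only [pertU_zero] using ih' ((L : ℤ) • z))
      (fun r => by simpa only [pertU_zero] using ih' ((L : ℤ) • z + boxVec L r))
      (fun r => by simpa only [pertU_zero] using hdom l hll z r)
    simpa only [pertU_zero] using h

end Tower

/-! ## §4 (3.193) ⇒ the linear term `Q_j(U)A`, and (3.194) as the definition of `F_{2,j}(U)` -/

section Linear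

variable (L : ℕ)

/-- `e^{iA}U` scaled along the ray: the chiral fluctuation of (3.193) at `tA` is the curve `pertU (iA) U t`.
[cite: Balaban1985BackgroundPropagators, (3.193) p.433] -/
theorem pertU_I_smul (A : Site d → 𝔸) (U : Site d → 𝔸ˣ) (t : ℂ) :
    (fun x => expUnit (I • (t • A) x) * U x) = pertU (fun x => I • A x) U t := by
  funext x
  rw [pertU_apply, Pi.smul_apply, smul_comm I t (A x)]

/-- **(3.193) EXPANDED IN `A`: THE LINEAR TERM EXISTS.**  For a background `U` satisfying the domain condition at the levels
`< j`, `t ↦ Q_j(U, tA)(y) = (1/i) log (e^{itA}U)‾ʲ(y)(Ūʲ(y))⁻¹` (r06's `B9AppChiral.Qj`) is differentiable at `t = 0` with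
derivative `(1/i)·lamTower L U (iA) j y` (the ratio curve passes through `1`, where `d log = id`:
`B7Eq78Linearization.hasDerivAt_mlog_comp`). [cite: Balaban1985BackgroundPropagators, (3.193)–(3.194) p.433] -/
theorem hasDerivAt_Qj [NormOneClass 𝔸] {U : Site d → 𝔸ˣ} {j : ℕ} (hdom : LogDom L U j) (A : Site d → 𝔸) (y : Site d) :
    HasDerivAt (fun t : ℂ => Qj L U (t • A) j y) (I⁻¹ • lamTower L U (fun x => I • A x) j y) 0 := by
  set μ : Site d → 𝔸 := fun x => I • A x with hμ
  -- the ratio curve `(u_t)‾ʲ(y)(Ūʲ(y))⁻¹` through `1`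
  have hR : HasDerivAt (fun t : ℂ => (((uavg L 1 (pertU μ U t) j y * (uavg L 1 U j y)⁻¹ : 𝔸ˣ)) : 𝔸))
      (lamTower L U μ j y) 0 := by
    have h := (hasDerivAt_uavg_pertU L (μ := μ) hdom j le_rfl y).mul_const ((((uavg L 1 U j y)⁻¹ : 𝔸ˣ)) : 𝔸)
    have e : (fun t : ℂ => (((uavg L 1 (pertU μ U t) j y * (uavg L 1 U j y)⁻¹ : 𝔸ˣ)) : 𝔸))
        = fun t => ((uavg L 1 (pertU μ U t) j y : 𝔸ˣ) : 𝔸) * ((((uavg L 1 U j y)⁻¹ : 𝔸ˣ)) : 𝔸) :=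
      funext fun t => Units.val_mul _ _
    rw [e]
    refine h.congr_deriv ?_
    rw [mul_assoc, Units.mul_inv, mul_one]
  have hR0 : (((uavg L 1 (pertU μ U 0) j y * (uavg L 1 U j y)⁻¹ : 𝔸ˣ)) : 𝔸) = 1 := by
    rw [pertU_zero, mul_inv_cancel, Units.val_one]
  have hlog := (hasDerivAt_mlog_comp hR0 hR).const_smul (I⁻¹ : ℂ)
  have e : (fun t : ℂ => Qj L U (t • A) j y)
      = fun t => (I⁻¹ : ℂ) • mlog (((uavg L 1 (pertU μ U t) j y * (uavg L 1 U j y)⁻¹ : 𝔸ˣ)) : 𝔸) := by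
    funext t
    rw [Qj_apply, pertU_I_smul]
  rw [e]
  exact hlog

/-- **The linear term `Q_j(U)A` of (3.194)** — print: "expanding in A, we can easily see that for the linear term we have …";
typed, as the tree types [5]'s «L(Q(V₀)A)» (`B7Prop3GeneralLinear.linQcov`), as the derivative at `0` of `t ↦ Q_j(U, tA)(y)`
along the complex ray. [cite: Balaban1985BackgroundPropagators, (3.194) p.433] -/
def linQj (U : Site d → 𝔸ˣ) (A : Site d → 𝔸) (j : ℕ) (y : Site d) : 𝔸 :=
  deriv (fun t : ℂ => Qj L U (t • A) j y) 0

/-- The linear term computed: `Q_j(U)A(y) = (1/i)·lamTower L U (iA) j y` under the domain condition.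
[cite: Balaban1985BackgroundPropagators, (3.194) p.433] -/
theorem linQj_eq [NormOneClass 𝔸] {U : Site d → 𝔸ˣ} {j : ℕ} (hdom : LogDom L U j) (A : Site d → 𝔸) (y : Site d) :
    linQj L U A j y = I⁻¹ • lamTower L U (fun x => I • A x) j y :=
  (hasDerivAt_Qj L hdom A y).deriv

/-- **The operator `F_{2,j}(U)` of (3.194)**, DEFINED: `F_{2,j}(U)A := Q_j(U)A − Q′_jA`, `Q′_j` = the `j`-fold block mean of site
functions (the operator `Q′_j` of (3.19) p. 394 at the external gauge field `1`, = (212) of [5] at `U₀ = 1`, the tree's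
`B7Eq214Flat.lamAvg L j`). [cite: Balaban1985BackgroundPropagators, (3.194) p.433] -/
def F2 (U : Site d → 𝔸ˣ) (A : Site d → 𝔸) (j : ℕ) (y : Site d) : 𝔸 :=
  linQj L U A j y - lamAvg L j A y

/-- **(3.194)**: `Q_j(U)A = Q′_jA + F_{2,j}(U)A` (the decomposition; «F_{2,j}(U) is small» is `B9Eq3194LinearTerm.norm_F2_le`).
[cite: Balaban1985BackgroundPropagators, (3.194) p.433] -/
theorem eq3194 (U : Site d → 𝔸ˣ) (A : Site d → 𝔸) (j : ℕ) (y : Site d) :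
    linQj L U A j y = lamAvg L j A y + F2 L U A j y := by
  rw [F2, add_sub_cancel]

/-- (3.194) with the linear term written out: `(1/i)·lamTower L U (iA) j y = Q′_jA(y) + F_{2,j}(U)A(y)` under the domain
condition. [cite: Balaban1985BackgroundPropagators, (3.194) p.433] -/
theorem F2_eq [NormOneClass 𝔸] {U : Site d → 𝔸ˣ} {j : ℕ} (hdom : LogDom L U j) (A : Site d → 𝔸) (y : Site d) :
    F2 L U A j y = I⁻¹ • lamTower L U (fun x => I • A x) j y - lamAvg L j A y := by
  rw [F2, linQj_eq L hdom]

end Linear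

end Literature.MathematicalPhysics.QuantumFieldTheory.Balaban1983to89.B9Eq3194Derivative
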